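import Summits.QuantumFields.BalabanUV.Beta.D1BFx.MomentTransferPeriodicEntry

/-!
# `BalabanUV.Beta.D1BFx.MomentTransferCross` — road «BF-x» for binder row D1, re-cut slot (K), row (K7) «TRANSFER-Δ» (part 1, generic):
# THE BLOCK-PERIODIC MOMENT TRANSFER WITHOUT ANY VANISHING HYPOTHESIS ON THE FINE KERNEL — the decimated second moment of the
# sandwich is `masses × Σ_{base points} (fine second moment)` PLUS AN EXPLICIT CROSS FUNCTIONAL `crossP` / `crossEntry` / `crossK`,
# LINEAR in the fine kernel, built from its column sums, first moments and row sums at the base points and the patterns' coset data;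
# it VANISHES under the record's hypotheses (columns, rows, base-point-summed first moments), which are thereby its corollary

HONEST DEPENDENCY (page 1, mandatory): continuum YM on T⁴ ⇐ BetaPertH ∧ nine spine estimates (0/9 proved); BetaPertH ⇐ (D1) ∧ (D4) ∧
CAP+tail; G-an2-4 gates asym, D1 and NE2/3/4.  HONEST FRAMING (cell contract, verbatim): «discharging `BetaPertH` makes Bałaban's UV
stability UNCONDITIONAL — a real constructive-QFT result; it is NOT the continuum limit and NOT the Clay problem.»  [folklore] bookkeeping of
absolutely convergent lattice sums over `ℝ`, composed BY NAME from the NINE-TERM MASTER IDENTITY `MomentTransferPeriodicMaster.hasSum_termP_second`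
(K-R5 part 1, which has NO vanishing hypothesis), the majorant engine of `MomentTransferPeriodicSum` and the solution-operator data
`MinimiserIdentityForm.lowMoments_wK` / `absMoment₂_wK`; nothing of the manuscripts under audit is asserted or cited; no `Prop` fact minted;
data definitions only ([our object]: the explicit moment functionals); 0∕4 row-D1 binders touched; slot (K) NOT closed; nothing of D1 ∕
BetaPertH discharged.  Value = kernel bookkeeping for the re-cut END of road BF-x (owner spec `HOME/b2b-balaban-beta-d1-p2/K-END-RECUT-SPEC.md`
§5 (K7), ruling ρ-g7-9: under (R2) no piece of the one-shot Hessian has vanishing Ward rows, only the total has, so slot (F) must be applied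
per piece WITH THE DEFECT DISPLAYED and the defects cancelled in the sum by linearity), NOT summit progress; NOT continuum, NOT Clay.

CONTENT (all [folklore] theorems; [our object] data defs `colSum`, `firstMom`, `rowSum`, `cosetM2`, `crossP`, `crossEntry`, `linC`, `crossK`):
* §1 SCALAR PATTERNS: `decimatedSumP_second_moment_cross` — patterns `w, w'` with `AbsMoment₂` reproducing constants (`σ, σ'`) and affine
  functions (`C, C'`) through `N•ℤ^d`, `P` block periodic with absolutely summable base-point kernels, NOTHING ELSE: the decimated second
  moment of the sandwich is `σσ'·Σ_b m₂(b) + crossP N σ C w σ' C' w' P κ λ` (the eight cross terms of the master identity with every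
  kernel moment an explicit `tsum`).
* §2 MATRIX ENTRIES: `secondMoment_dressedEntryP_hasSum_lattice_cross`, `bondSecondMomentP_hasSum_four_cross` (`d = 4`: value
  `avgM2 N (P a b) κ λ + N⁶ · crossEntry …`).
* §3 THE TYPED SOLUTION OPERATOR `wK N`: its affine-reproduction constants as explicit `tsum`s (`linC`, `linReproSum_linC`), the defect
  `crossK N P κ λ a b`, and `bondSecondMomentP_solutionOp_four_cross` — hypotheses on `P`: block periodicity and absolute summability ONLY.
* §4 LINEARITY (`crossP_add`, `crossP_smul`, `crossK_add`, `crossK_smul`) and VANISHING (`crossP_eq_zero`, `crossK_eq_zero`: columns and rows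
  summing to zero pointwise + base-point-summed first moments zero ⟹ defect `0`); CONSISTENCY: the record's
  `MomentTransferPeriodicEntry.bondSecondMomentP_solutionOp_four` re-derived from the cross form.
-/

namespace Summit.QuantumFields.BalabanUV.Beta.D1BFx.MomentTransferCross

open Finset Filter Topology
open Literature.MathematicalPhysics.QuantumFieldTheory.Balaban1983to89
open Literature.MathematicalPhysics.QuantumFieldTheory.Balaban1983to89.Beta
open DecimatedMoment (cosetInd)
open DecimatedMomentLimit (abs_cosetInd_le_one)
open DecimatedMomentSummable (IsMoment₂ ConstReproSum LinReproSum AbsMoment₂ summable_of_absMoment₂ summable_smul_of_absMoment₂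
  summable_window_smul_of_absMoment₂)
open DressedMomentNormalisation (EKer resSite)
open MomentTransferPeriodic MomentTransferPeriodicMaster MomentTransferPeriodicSum MomentTransferPeriodicEntry
open MinimiserIdentityForm (wK lowMoments_wK absMoment₂_wK)

variable {d N : ℕ}

/-! ## §1 The explicit moment functionals and the cross term for scalar patterns -/

/-- [our object] COLUMN SUM of a two-point kernel at the base point `b`: `colSum P b := Σ'_t P (b+t) b`.  A DEFINITION (a `tsum`). -/
noncomputable def colSum (P : Ker₂ d) (b : Fin d → ℤ) : ℝ := ∑' t, baseKer P b t

/-- [our object] FIRST MOMENT of a two-point kernel at the base point `b`: `firstMom P μ b := Σ'_t t_μ · P (b+t) b`.  A DEFINITION. -/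
noncomputable def firstMom (P : Ker₂ d) (μ : Fin d) (b : Fin d → ℤ) : ℝ := ∑' t, (t μ : ℝ) * baseKer P b t

/-- [our object] ROW SUM of a two-point kernel at the point `b`: `rowSum P b := Σ'_{s'} P b s'`.  A DEFINITION. -/
noncomputable def rowSum (P : Ker₂ d) (b : Fin d → ℤ) : ℝ := ∑' s', P b s'

/-- [our object] COSET SECOND MOMENT of a pattern through the window `N•ℤ^d` at `a`: `cosetM2 N w κ λ a := Σ'_x cosetInd N (a − x)·x_κ x_λ·w x`.
A DEFINITION. -/
noncomputable def cosetM2 (N : ℕ) (w : (Fin d → ℤ) → ℝ) (κ l : Fin d) (a : Fin d → ℤ) : ℝ :=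
  ∑' x, (cosetInd N (a - x) * (x κ * x l)) • w x

/-- [our object] **THE CROSS FUNCTIONAL** of the nine-term master identity (its eight non-principal terms), for scalar patterns with constant ∕
affine reproduction data `(σ, C)` (left), `(σ', C')` (right): every kernel moment is the explicit `tsum` `colSum` ∕ `firstMom` ∕ `rowSum` summed
over the `N^d` base points, every pattern moment the explicit `cosetM2`.  LINEAR in `P` (§4).  A DEFINITION; asserts nothing. -/
noncomputable def crossP (N : ℕ) (σ : ℝ) (C : Fin d → ℝ) (w : (Fin d → ℤ) → ℝ) (σ' : ℝ) (C' : Fin d → ℝ) (w' : (Fin d → ℤ) → ℝ)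
    (P : Ker₂ d) (κ l : Fin d) : ℝ :=
  σ * (∑ r : Fin d → Fin N, firstMom P κ (resSite r) * C' l)
    + σ * (∑ r : Fin d → Fin N, firstMom P l (resSite r) * C' κ)
    - C l * (∑ r : Fin d → Fin N, firstMom P κ (resSite r) * σ')
    - C κ * (∑ r : Fin d → Fin N, firstMom P l (resSite r) * σ')
    + σ * (∑ r : Fin d → Fin N, colSum P (resSite r) * cosetM2 N w' κ l (resSite r))
    - C l * (∑ r : Fin d → Fin N, colSum P (resSite r) * C' κ)
    - C κ * (∑ r : Fin d → Fin N, colSum P (resSite r) * C' l)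
    + σ' * (∑ r : Fin d → Fin N, rowSum P (resSite r) * cosetM2 N w κ l (resSite r))

/-- [folklore] The coset second-moment family of a pattern with absolutely summable second moment HAS THE SUM `cosetM2`. -/
theorem hasSum_cosetM2 {w : (Fin d → ℤ) → ℝ} (hw : AbsMoment₂ w) (κ l : Fin d) (a : Fin d → ℤ) :
    HasSum (fun x => (cosetInd N (a - x) * (x κ * x l)) • w x) (cosetM2 N w κ l a) :=
  (summable_window_smul_of_absMoment₂ hw (χ := fun x => cosetInd N (a - x)) (fun x => abs_cosetInd_le_one N (a - x))
    (IsMoment₂.coord2 κ l)).hasSum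

/-- [folklore] **THE BLOCK-PERIODIC MOMENT TRANSFER WITH THE CROSS TERMS DISPLAYED — NO VANISHING HYPOTHESIS ON THE KERNEL** (`0 < N`).
Patterns `w, w'` with absolutely summable second moments reproducing constants (`σ`, `σ'`) AND affine functions (`C`, `C'`) through `N•ℤ^d`;
`P` block periodic with absolutely summable base-point kernels.  Then the `N•ℤ^d`-windowed second moment of the sandwich — as the triple family
and as `Σ_y (cosetInd N y · y_κ y_λ) • dressedSumP w P w' y` — HAS THE SUM `σ·σ'·Σ_{classes b} Σ'_t t_κ t_λ P (b+t) b + crossP N σ C w σ' C' w' P κ λ`.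
ONE application of the master identity `hasSum_termP_second` with every moment family summed by the majorant engine. -/
theorem decimatedSumP_second_moment_cross (hN : 0 < N) {w w' : (Fin d → ℤ) → ℝ} {P : Ker₂ d} (hP : IsBlockPeriodic N P)
    (hw : AbsMoment₂ w) (hw' : AbsMoment₂ w') (hPabs : ∀ b, AbsMoment₂ (baseKer P b)) {σ σ' : ℝ} {C C' : Fin d → ℝ}
    (hL0 : ConstReproSum N w σ) (hL1 : LinReproSum N w C) (hR0 : ConstReproSum N w' σ') (hR1 : LinReproSum N w' C')
    (κ l : Fin d) :
    HasSum (termP N w P w' (fun u t x => (t + x - u) κ * (t + x - u) l))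
        (σ * σ' * (∑ r : Fin d → Fin N, ∑' t, (t κ : ℝ) * (t l : ℝ) * baseKer P (resSite r) t) + crossP N σ C w σ' C' w' P κ l)
      ∧ HasSum (fun y => (cosetInd N y * (y κ * y l)) • dressedSumP w P w' y)
        (σ * σ' * (∑ r : Fin d → Fin N, ∑' t, (t κ : ℝ) * (t l : ℝ) * baseKer P (resSite r) t) + crossP N σ C w σ' C' w' P κ l) := by
  have hF : AbsMoment₂ (periodicMajorant N P) := absMoment₂_periodicMajorant hPabs
  have hPF : ∀ b t, |P (b + t) b| ≤ periodicMajorant N P t := abs_baseKer_le_periodicMajorant hN hP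
  have hS : MonoSummableP N w P w' := monoSummableP_of_majorant hw hF hw' hPF
  have hm0 : ∀ b, HasSum (baseKer P b) (colSum P b) := fun b => (summable_of_absMoment₂ (hPabs b)).hasSum
  have hrow : ∀ b, HasSum (P b) (rowSum P b) := fun b => (summable_row_of_majorant hF hPF b).hasSum
  have A := hasSum_termP_second w P w' hN hP hL0 hL1 hR0 hR1 κ l (m₀ := colSum P) (R₀ := rowSum P)
    (n₂ := cosetM2 N w' κ l) (p₂ := cosetM2 N w κ l) (m₁ := fun μ b => firstMom P μ b)
    (m₂ := fun b => ∑' t, (t κ : ℝ) * (t l : ℝ) * baseKer P b t)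
    hm0 (fun b μ => (hasSum_moments_baseKer hPabs b μ l).1) (fun b => (hasSum_moments_baseKer hPabs b κ l).2) hrow
    (fun a => hasSum_cosetM2 hw' κ l a) (fun a => hasSum_cosetM2 hw κ l a) hS
  have e : σ * (∑ r : Fin d → Fin N, (∑' t, (t κ : ℝ) * (t l : ℝ) * baseKer P (resSite r) t) * σ')
        + σ * (∑ r : Fin d → Fin N, firstMom P κ (resSite r) * C' l)
        + σ * (∑ r : Fin d → Fin N, firstMom P l (resSite r) * C' κ)
        - C l * (∑ r : Fin d → Fin N, firstMom P κ (resSite r) * σ')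
        - C κ * (∑ r : Fin d → Fin N, firstMom P l (resSite r) * σ')
        + σ * (∑ r : Fin d → Fin N, colSum P (resSite r) * cosetM2 N w' κ l (resSite r))
        - C l * (∑ r : Fin d → Fin N, colSum P (resSite r) * C' κ)
        - C κ * (∑ r : Fin d → Fin N, colSum P (resSite r) * C' l)
        + σ' * (∑ r : Fin d → Fin N, rowSum P (resSite r) * cosetM2 N w κ l (resSite r))
      = σ * σ' * (∑ r : Fin d → Fin N, ∑' t, (t κ : ℝ) * (t l : ℝ) * baseKer P (resSite r) t)
        + crossP N σ C w σ' C' w' P κ l := by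
    rw [crossP, ← Finset.sum_mul]
    ring
  rw [e] at A
  exact ⟨A, hasSum_coarseP w P w' (fun y => y κ * y l) A (summable_dressedP_fibre hw hF hw' hPF)⟩

/-- [folklore] **… ON THE COARSE LATTICE** (`y = N • z`, weight `N² · z_κ z_λ`). -/
theorem decimatedSumP_second_moment_lattice_cross (hN : 0 < N) {w w' : (Fin d → ℤ) → ℝ} {P : Ker₂ d}
    (hP : IsBlockPeriodic N P) (hw : AbsMoment₂ w) (hw' : AbsMoment₂ w') (hPabs : ∀ b, AbsMoment₂ (baseKer P b))
    {σ σ' : ℝ} {C C' : Fin d → ℝ}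
    (hL0 : ConstReproSum N w σ) (hL1 : LinReproSum N w C) (hR0 : ConstReproSum N w' σ') (hR1 : LinReproSum N w' C')
    (κ l : Fin d) :
    HasSum (fun z : Fin d → ℤ => ((N : ℤ) ^ 2 * (z κ * z l)) • dressedSumP w P w' ((N : ℤ) • z))
      (σ * σ' * (∑ r : Fin d → Fin N, ∑' t, (t κ : ℝ) * (t l : ℝ) * baseKer P (resSite r) t) + crossP N σ C w σ' C' w' P κ l) :=
  (hasSum_latticeP_iff hN.ne' _ κ l _).2 (decimatedSumP_second_moment_cross hN hP hw hw' hPabs hL0 hL1 hR0 hR1 κ l).2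

/-! ## §2 Matrix entries of the sandwich -/

/-- [our object] **THE CROSS FUNCTIONAL OF AN ENTRY OF THE SANDWICH**: for a matrix pattern `w` with (L0∞) Kronecker masses `δ·N^{−(d+1)}` and
affine-reproduction constants `C κ λ`, the `(a,b)` entry of `wᵀ·P·w` has the cross term `Σ_{c,e} crossP N σ_{ca} (C c a) (w c a) σ'_{eb} (C e b) (w e b) (P c e) κ λ`
(every entry `P c e` of the fine kernel contributes).  LINEAR in `P`.  A DEFINITION; asserts nothing. -/
noncomputable def crossEntry (N : ℕ) (w : EKer d) (C : Fin d → Fin d → Fin d → ℝ) (P : EKer₂ d) (κ l a b : Fin d) : ℝ :=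
  ∑ c, ∑ e, crossP N (if c = a then (((N : ℝ) ^ (d + 1))⁻¹) else 0) (C c a) (w c a)
    (if e = b then (((N : ℝ) ^ (d + 1))⁻¹) else 0) (C e b) (w e b) (P c e) κ l

/-- [folklore] **THE DECIMATED SECOND MOMENT OF AN ENTRY OF THE SANDWICH, CROSS TERMS DISPLAYED** (spec normalisation; `0 < N`): response kernel `w`
with entrywise (L0∞) Kronecker masses `δ_{κl}·N^{−(d+1)}`, entrywise (L1∞) constants `C κ λ` and absolutely summable second moments; fine kernel
entries block periodic with absolutely summable base-point kernels — NOTHING ELSE.  Then `z ↦ (N² z_κ z_λ) • K_{ab}(N z)` HAS THE SUM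
`N^{−(d+2)} · avgM2 N (P a b) κ λ + crossEntry N w C P κ λ a b`. -/
theorem secondMoment_dressedEntryP_hasSum_lattice_cross (hN : 0 < N) (w : EKer d) (P : EKer₂ d)
    (hP : ∀ c e, IsBlockPeriodic N (P c e))
    (hw0 : ∀ κ l, ConstReproSum N (w κ l) (if κ = l then (((N : ℝ) ^ (d + 1))⁻¹) else 0))
    {C : Fin d → Fin d → Fin d → ℝ} (hw1 : ∀ κ l, LinReproSum N (w κ l) (C κ l))
    (hwA : ∀ κ l, AbsMoment₂ (w κ l)) (hPA : ∀ c e b, AbsMoment₂ (baseKer (P c e) b)) (κ lam a b : Fin d) :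
    HasSum (fun z : Fin d → ℤ => ((N : ℤ) ^ 2 * (z κ * z lam)) • dressedEntryP w P ((N : ℤ) • z) a b)
      ((((N : ℝ) ^ (d + 2))⁻¹) * avgM2 N (P a b) κ lam + crossEntry N w C P κ lam a b) := by
  have hN' : (N : ℝ) ≠ 0 := by exact_mod_cast hN.ne'
  have hce : ∀ c e : Fin d,
      HasSum (fun z : Fin d → ℤ => ((N : ℤ) ^ 2 * (z κ * z lam)) • dressedSumP (w c a) (P c e) (w e b) ((N : ℤ) • z))
        ((if c = a then (((N : ℝ) ^ (d + 1))⁻¹) else 0) * (if e = b then (((N : ℝ) ^ (d + 1))⁻¹) else 0)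
            * (∑ r : Fin d → Fin N, ∑' t, (t κ : ℝ) * (t lam : ℝ) * baseKer (P c e) (resSite r) t)
          + crossP N (if c = a then (((N : ℝ) ^ (d + 1))⁻¹) else 0) (C c a) (w c a)
              (if e = b then (((N : ℝ) ^ (d + 1))⁻¹) else 0) (C e b) (w e b) (P c e) κ lam) :=
    fun c e => decimatedSumP_second_moment_lattice_cross hN (hP c e) (hwA c a) (hwA e b) (hPA c e) (hw0 c a) (hw1 c a)
      (hw0 e b) (hw1 e b) κ lam
  have hs := hasSum_sum (s := (Finset.univ : Finset (Fin d)))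
    (fun c _ => hasSum_sum (s := (Finset.univ : Finset (Fin d))) (fun e _ => hce c e))
  have hval : ∑ c, ∑ e, ((if c = a then (((N : ℝ) ^ (d + 1))⁻¹) else 0) * (if e = b then (((N : ℝ) ^ (d + 1))⁻¹) else 0)
          * (∑ r : Fin d → Fin N, ∑' t, (t κ : ℝ) * (t lam : ℝ) * baseKer (P c e) (resSite r) t)
        + crossP N (if c = a then (((N : ℝ) ^ (d + 1))⁻¹) else 0) (C c a) (w c a)
            (if e = b then (((N : ℝ) ^ (d + 1))⁻¹) else 0) (C e b) (w e b) (P c e) κ lam)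
      = (((N : ℝ) ^ (d + 2))⁻¹) * avgM2 N (P a b) κ lam + crossEntry N w C P κ lam a b := by
    simp only [Finset.sum_add_distrib]
    rw [crossEntry, add_left_inj]
    simp only [mul_ite, mul_zero, ite_mul, zero_mul, Finset.sum_ite_eq', Finset.mem_univ, if_true]
    unfold avgM2
    field_simp
    ring
  rw [hval] at hs
  refine hs.congr_fun (fun z => ?_)
  simp only [dressedEntryP, Finset.smul_sum]

/-- [folklore] **`d = 4`, BOND NORMALISATION, CROSS TERMS DISPLAYED**: the coarse bond second moment of the `(a,b)` entry of the sandwich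
`z ↦ z_κ z_λ · N⁸ · K_{ab}(N z)` HAS THE SUM `avgM2 N (P a b) κ λ + N⁶ · crossEntry N w C P κ λ a b`. -/
theorem bondSecondMomentP_hasSum_four_cross (hN : 0 < N) (w : EKer 4) (P : EKer₂ 4)
    (hP : ∀ c e, IsBlockPeriodic N (P c e))
    (hw0 : ∀ κ l, ConstReproSum N (w κ l) (if κ = l then (((N : ℝ) ^ (4 + 1))⁻¹) else 0))
    {C : Fin 4 → Fin 4 → Fin 4 → ℝ} (hw1 : ∀ κ l, LinReproSum N (w κ l) (C κ l))
    (hwA : ∀ κ l, AbsMoment₂ (w κ l)) (hPA : ∀ c e b, AbsMoment₂ (baseKer (P c e) b)) (κ lam a b : Fin 4) :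
    HasSum (fun z : Fin 4 → ℤ => ((z κ * z lam : ℤ) : ℝ) * ((N : ℝ) ^ 8 * dressedEntryP w P ((N : ℤ) • z) a b))
      (avgM2 N (P a b) κ lam + (N : ℝ) ^ 6 * crossEntry N w C P κ lam a b) := by
  have hN' : (N : ℝ) ≠ 0 := by exact_mod_cast hN.ne'
  have h := (secondMoment_dressedEntryP_hasSum_lattice_cross hN w P hP hw0 hw1 hwA hPA κ lam a b).mul_left ((N : ℝ) ^ 6)
  have hval : (N : ℝ) ^ 6 * ((((N : ℝ) ^ (4 + 2))⁻¹) * avgM2 N (P a b) κ lam + crossEntry N w C P κ lam a b)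
      = avgM2 N (P a b) κ lam + (N : ℝ) ^ 6 * crossEntry N w C P κ lam a b := by
    field_simp
  rw [hval] at h
  refine h.congr_fun (fun z => ?_)
  simp only [zsmul_eq_mul, Int.cast_mul, Int.cast_pow, Int.cast_natCast]
  ring

/-! ## §3 The dressing side discharged: the typed KKT solution operator's response kernel `wK N` -/

section SolutionOperator

variable (N) [NeZero N]

/-- [our object] THE AFFINE-REPRODUCTION CONSTANTS OF `wK N` AS EXPLICIT SUMS: `linC N κ λ μ := Σ'_u cosetInd N (0 − u)·u_μ·wK N κ λ u` (the (L1∞)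
constants of `MinimiserIdentityForm.lowMoments_wK`, which the tree states existentially, read at the coset of `0`).  A DEFINITION. -/
noncomputable def linC (κ l : Fin 4) (μ : Fin 4) : ℝ := ∑' u, (cosetInd N (0 - u) * u μ) • wK N κ l u

/-- [folklore] `wK N κ λ` reproduces affine functions through `N•ℤ⁴` with the EXPLICIT constants `linC N κ λ` (uniqueness of sums). -/
theorem linReproSum_linC (κ l : Fin 4) : LinReproSum N (wK N κ l) (linC N κ l) := by
  obtain ⟨C, hC⟩ := (lowMoments_wK (N := N)).2 κ l
  have e : linC N κ l = C := funext fun μ => (hC 0 μ).tsum_eq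
  rw [e]
  exact hC

/-- [our object] **THE TRANSFER DEFECT** of a block-periodic matrix two-point kernel `P` dressed by the solution operator `wK N`, in coarse BOND
currency: `crossK N P κ λ a b := N⁶ · crossEntry N (wK N) (linC N) P κ λ a b`.  LINEAR in `P` (`crossK_add`, `crossK_smul`); `0` when the columns
and rows of every entry sum to zero and the base-point-summed first moments vanish (`crossK_eq_zero`).  A DEFINITION; asserts nothing. -/
noncomputable def crossK (P : EKer₂ 4) (κ lam a b : Fin 4) : ℝ := (N : ℝ) ^ 6 * crossEntry N (wK N) (linC N) P κ lam a b

/-- [folklore] **THE SANDWICH DRESSED BY THE TYPED SOLUTION OPERATOR, DEFECT DISPLAYED** (`d + 1 = 4`, block size `N ≠ 0`): for ANY block-periodic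
matrix two-point kernel `P` with absolutely summable base-point kernels — NO column ∕ row ∕ first-moment hypothesis — the coarse BOND second moment
of `wKᵀ·P·wK` EQUALS `avgM2 N (P a b) κ λ + crossK N P κ λ a b`. -/
theorem bondSecondMomentP_solutionOp_four_cross (P : EKer₂ 4) (hP : ∀ c e, IsBlockPeriodic N (P c e))
    (hPA : ∀ c e b, AbsMoment₂ (baseKer (P c e) b)) (κ lam a b : Fin 4) :
    ∑' z : Fin 4 → ℤ, ((z κ * z lam : ℤ) : ℝ) * ((N : ℝ) ^ 8 * dressedEntryP (wK N) P ((N : ℤ) • z) a b)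
      = avgM2 N (P a b) κ lam + crossK N P κ lam a b :=
  (bondSecondMomentP_hasSum_four_cross (Nat.pos_of_ne_zero (NeZero.ne N)) (wK N) P hP lowMoments_wK.1
    (fun κ l => linReproSum_linC N κ l) absMoment₂_wK hPA κ lam a b).tsum_eq

end SolutionOperator

/-! ## §4 Linearity and vanishing of the defect -/

section Linear

variable {σ σ' : ℝ} {C C' : Fin d → ℝ} {w w' : (Fin d → ℤ) → ℝ}

/-- [folklore] Row summability of a block-periodic kernel with absolutely summable base-point kernels (periodic majorant). -/
theorem summable_row (hN : 0 < N) {P : Ker₂ d} (hP : IsBlockPeriodic N P) (hPabs : ∀ b, AbsMoment₂ (baseKer P b)) (b : Fin d → ℤ) :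
    Summable (P b) :=
  summable_row_of_majorant (absMoment₂_periodicMajorant hPabs) (abs_baseKer_le_periodicMajorant hN hP) b

/-- [folklore] **`crossP` IS ADDITIVE IN THE KERNEL** (both kernels block periodic with absolutely summable base-point kernels, `0 < N`). -/
theorem crossP_add (hN : 0 < N) {P Q : Ker₂ d} (hP : IsBlockPeriodic N P) (hQ : IsBlockPeriodic N Q)
    (hPabs : ∀ b, AbsMoment₂ (baseKer P b)) (hQabs : ∀ b, AbsMoment₂ (baseKer Q b)) (κ l : Fin d) :
    crossP N σ C w σ' C' w' (P + Q) κ l = crossP N σ C w σ' C' w' P κ l + crossP N σ C w σ' C' w' Q κ l := by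
  have h0 : ∀ b, colSum (P + Q) b = colSum P b + colSum Q b := fun b => by
    unfold colSum
    rw [← (summable_of_absMoment₂ (hPabs b)).tsum_add (summable_of_absMoment₂ (hQabs b))]
    rfl
  have hs : ∀ {R : Ker₂ d}, (∀ b, AbsMoment₂ (baseKer R b)) → ∀ μ b, Summable (fun t => (t μ : ℝ) * baseKer R b t) :=
    fun hR μ b => (hasSum_moments_baseKer hR b μ μ).1.summable.congr fun t => by rw [zsmul_eq_mul]
  have h1 : ∀ μ b, firstMom (P + Q) μ b = firstMom P μ b + firstMom Q μ b := fun μ b => by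
    unfold firstMom
    rw [← (hs hPabs μ b).tsum_add (hs hQabs μ b)]
    refine tsum_congr fun t => ?_
    simp only [baseKer, Pi.add_apply]
    ring
  have hR : ∀ b, rowSum (P + Q) b = rowSum P b + rowSum Q b := fun b => by
    unfold rowSum
    rw [← (summable_row hN hP hPabs b).tsum_add (summable_row hN hQ hQabs b)]
    rfl
  simp only [crossP, h0, h1, hR, add_mul, Finset.sum_add_distrib]
  ring

/-- [folklore] **`crossP` IS HOMOGENEOUS IN THE KERNEL** (no hypothesis). -/
theorem crossP_smul (c : ℝ) (P : Ker₂ d) (κ l : Fin d) :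
    crossP N σ C w σ' C' w' (c • P) κ l = c * crossP N σ C w σ' C' w' P κ l := by
  have h0 : ∀ b, colSum (c • P) b = c * colSum P b := fun b => by
    unfold colSum
    rw [← tsum_mul_left]
    rfl
  have h1 : ∀ μ b, firstMom (c • P) μ b = c * firstMom P μ b := fun μ b => by
    unfold firstMom
    rw [← tsum_mul_left]
    refine tsum_congr fun t => ?_
    simp only [baseKer, Pi.smul_apply, smul_eq_mul]
    ring
  have hR : ∀ b, rowSum (c • P) b = c * rowSum P b := fun b => by
    unfold rowSum
    rw [← tsum_mul_left]
    rfl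
  simp only [crossP, h0, h1, hR, mul_assoc, ← Finset.mul_sum]
  ring

/-- [folklore] **`crossP` VANISHES UNDER THE RECORD'S HYPOTHESES**: columns and rows summing to zero at every base point and base-point-summed
first moments zero. -/
theorem crossP_eq_zero {P : Ker₂ d} (hcol : ∀ b, HasSum (baseKer P b) 0) (hrow : ∀ b, HasSum (P b) 0)
    (hT1 : ∀ μ, ∑ r : Fin d → Fin N, firstMom P μ (resSite r) = 0) (κ l : Fin d) :
    crossP N σ C w σ' C' w' P κ l = 0 := by
  have h0 : ∀ b, colSum P b = 0 := fun b => (hcol b).tsum_eq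
  have hR : ∀ b, rowSum P b = 0 := fun b => (hrow b).tsum_eq
  simp only [crossP, h0, hR, zero_mul, Finset.sum_const_zero, mul_zero, add_zero, sub_zero, ← Finset.sum_mul, hT1]

end Linear

section LinearK

variable (N) [NeZero N]

/-- [folklore] **THE TRANSFER DEFECT IS ADDITIVE IN THE FINE KERNEL** (entries block periodic with absolutely summable base-point kernels) — the
bookkeeping by which per-piece defects are summed to the defect of the total kernel. -/
theorem crossK_add {P Q : EKer₂ 4} (hP : ∀ c e, IsBlockPeriodic N (P c e)) (hQ : ∀ c e, IsBlockPeriodic N (Q c e))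
    (hPA : ∀ c e b, AbsMoment₂ (baseKer (P c e) b)) (hQA : ∀ c e b, AbsMoment₂ (baseKer (Q c e) b)) (κ lam a b : Fin 4) :
    crossK N (P + Q) κ lam a b = crossK N P κ lam a b + crossK N Q κ lam a b := by
  have hN : 0 < N := Nat.pos_of_ne_zero (NeZero.ne N)
  simp only [crossK, crossEntry, Pi.add_apply, crossP_add hN (hP _ _) (hQ _ _) (hPA _ _) (hQA _ _), Finset.sum_add_distrib, mul_add]

/-- [folklore] **THE TRANSFER DEFECT IS HOMOGENEOUS IN THE FINE KERNEL** (no hypothesis) — weights of pieces pass through. -/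
theorem crossK_smul (c : ℝ) (P : EKer₂ 4) (κ lam a b : Fin 4) : crossK N (c • P) κ lam a b = c * crossK N P κ lam a b := by
  simp only [crossK, crossEntry, Pi.smul_apply, crossP_smul, ← Finset.mul_sum]
  ring

/-- [folklore] **THE TRANSFER DEFECT VANISHES UNDER THE RECORD'S HYPOTHESES** — columns and rows of every entry summing to zero pointwise and
base-point-summed first moments zero (EXACTLY the `hcol`∕`hrow`∕`hT1` of `MomentTransferPeriodicEntry.bondSecondMomentP_solutionOp_four`). -/
theorem crossK_eq_zero {P : EKer₂ 4} (hcol : ∀ c e b, HasSum (fun s => P c e s b) 0) (hrow : ∀ c e b, HasSum (P c e b) 0)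
    (hT1 : ∀ c e (μ : Fin 4), ∑ r : Fin 4 → Fin N, ∑' t, (t μ : ℝ) * baseKer (P c e) (resSite r) t = 0) (κ lam a b : Fin 4) :
    crossK N P κ lam a b = 0 := by
  have hcol' : ∀ c e b, HasSum (baseKer (P c e) b) 0 := fun c e b =>
    ((Equiv.hasSum_iff (Equiv.addLeft b)).mpr (hcol c e b)).congr_fun (fun _ => rfl)
  have hz : ∀ c e, crossP N (if c = a then (((N : ℝ) ^ (4 + 1))⁻¹) else 0) (linC N c a) (wK N c a)
      (if e = b then (((N : ℝ) ^ (4 + 1))⁻¹) else 0) (linC N e b) (wK N e b) (P c e) κ lam = 0 :=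
    fun c e => crossP_eq_zero (hcol' c e) (hrow c e) (hT1 c e) κ lam
  simp only [crossK, crossEntry, hz, Finset.sum_const_zero, mul_zero]

/-- [folklore] CONSISTENCY: the record's `MomentTransferPeriodicEntry.bondSecondMomentP_solutionOp_four` IS the cross form with a vanishing defect
(re-derived; the statement is the landed theorem's, verbatim). -/
theorem bondSecondMomentP_solutionOp_four_of_cross (P : EKer₂ 4) (hP : ∀ c e, IsBlockPeriodic N (P c e))
    (hPA : ∀ c e b, AbsMoment₂ (baseKer (P c e) b))
    (hcol : ∀ c e b, HasSum (fun s => P c e s b) 0) (hrow : ∀ c e b, HasSum (P c e b) 0)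
    (hT1 : ∀ c e (μ : Fin 4), ∑ r : Fin 4 → Fin N, ∑' t, (t μ : ℝ) * baseKer (P c e) (resSite r) t = 0)
    (κ lam a b : Fin 4) :
    ∑' z : Fin 4 → ℤ, ((z κ * z lam : ℤ) : ℝ) * ((N : ℝ) ^ 8 * dressedEntryP (wK N) P ((N : ℤ) • z) a b)
      = avgM2 N (P a b) κ lam := by
  rw [bondSecondMomentP_solutionOp_four_cross N P hP hPA, crossK_eq_zero N hcol hrow hT1, add_zero]

end LinearK

end Summit.QuantumFields.BalabanUV.Beta.D1BFx.MomentTransferCross
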